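import Summits.QuantumFields.BalabanUV.T4Continuum.Support.NE7HintOfUhlenbeckChartGeneric
import Summits.QuantumFields.BalabanUV.T4Continuum.Support.NE7PairResidualSupRepGeneric
import Summits.QuantumFields.BalabanUV.T4Continuum.Support.AveragingDeficitMultiLevelBridge
import HarnessLib

/-!
# NE7HintOfSliceNormalisationGeneric — PORT MAP P2, FILE 5: (8)∃ OVER THE HONEST BINDER WITH THE PAIR's RELATIVE SUP DATUM SUPPLIED, FOR EVERY UNITARY GAUGE GROUP `U(n)` AND EVERY
# BLOCK SIZE `L ≥ 2` ON T⁴ — `NE7HintOfSliceNormalisationSU2DecSlice.hint_SU2_of_decomposition` (`card n = 2`, `L = 2`) RE-ISSUED GENERICALLY over P2.4 `hint_generic` and P2.5b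
# `pair_residual_sup_rep_generic`; the numeric line `10²¹·card n·ε ≤ 1` becomes the radius cap `ε ≤ 1∕(2·10²¹·L⁶·card n)` folded into `ε₀`

Cell `pub-balaban`, rung (B)+1 sub-cell t4, lineage `b2b-balaban-t4-ne7-p1`, generation 109 (CRUX PROVER NE7 #1 = OWNER of BINDER row NE7).  Memo
`t4/b2b-balaban-t4-ne7-p1-g109/ROAD-G109.md` §3 (PORT MAP item P2.5).
WHAT ([folklore]; 0 def, 0 sorry).  **`hint_of_decomposition_generic`**: for every `L ≥ 2`: `∃ C_E > 0, ∃ ℓ ≥ 1, ∃ ε₀ > 0, ∀ 0 < ε ≤ ε₀, ∃ β₀ > 0, ∀ 0 < β ≤ β₀, ∀ N ≥ 1, ∀ αh νh κh`: the strict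
line (with `C_E`) and `hdecomp♭` (the decomposition `X = X_T + X_N` over `𝒯_E` with its two energy letters, FROM a given residual near-representative `u₀` — unitary, `(N·M)`-periodic,
corner-trivial, `‖U_s(b)⁻¹U′^{u₀}(b) − 1‖ ≤ 10³⁴ε∕M`) ⟹ `∃ δ_V > 0`, over the small data every level has a constrained minimiser over `sfClass 4 L N ε` with `SmallField U a`,
`0 ≤ a < ε∕(L^k)²` — TOKEN FOR TOKEN under the recipe.
HONEST FRAMING (page 1): composition of landed kernel theorems; constants existential; nothing of Bałaban's asserted; `hdecomp♭` and the strict line REMAIN HYPOTHESES (their generic discharge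
= PORT MAP P2.6: `hdecomp_of_nl0` generic + `line_of_small_card`); NE7 NOT proved; spine 0∕9; finite T⁴ rung (B)+1 — NOT infinite volume, NOT mass gap, NOT BetaPertH, NOT Clay (continuum
YM on T⁴ ⇐ BetaPertH ∧ nine spine estimates).
-/

set_option autoImplicit false

open scoped BigOperators Matrix Matrix.Norms.L2Operator Topology
open NormedSpace Finset Set Filter

namespace Summit.QuantumFields.BalabanUV.T4Continuum.NE7HintOfSliceNormalisationGeneric

open Literature.MathematicalPhysics.QuantumFieldTheory.Balaban1983to89
open B7Prop1Explicit B7Prop2Explicit MatrixLog UnitaryModel MatrixNorms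
open T4AveragingDeficitWall (Ad IsUnitaryCfg IsSkewDir SmallField vary curl curlSq dirSq dirL1)
open T4AveragingDeficitWallBoundary (IsPeriodicCfg periodBox)
open AveragingDeficitPeriodicCounting (IsPeriodicDir)
open AveragingDeficitMultiLevelPrep (LevelSmall tower TangentIter cavgIter)
open AveragingDeficitMultiLevelBridge (cavgIter_eq_avgIter)
open BlockAverageVaryHolo (nbRad)
open MinimalActionLevels (perWin)
open MinimalActionSandwich (IsMinimiser admissible)
open MinimalActionRate (sfClass)
open NE3HessForm (dAction)
open NE3EnergyShapes (IsUnitarySite IsPeriodicSite)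
open NE7HintOfUhlenbeckChartGeneric (hint_generic)
open NE3EnergyWeightedShapes (energyNormW)
open NE7MeanZeroGaugeSliceW (energyBlockLandauW)
open NE7PairResidualSupRepGeneric (pair_residual_sup_rep_generic)

variable {n : Type} [Fintype n] [DecidableEq n]

/-- **P2.5 — ROW NE7's (8)∃ OVER THE HONEST BINDER, THE PAIR's RELATIVE SUP DATUM SUPPLIED, every `U(n)`, every `L ≥ 2`, on T⁴** (statement in the file header). [folklore] -/
theorem hint_of_decomposition_generic [Nonempty n] {L : ℕ} (hL : 2 ≤ L) :
    ∃ CE : ℝ, 0 < CE ∧ ∃ ℓ : ℕ, 1 ≤ ℓ ∧ ∃ ε₀ : ℝ, 0 < ε₀ ∧ ∀ ε : ℝ, 0 < ε → ε ≤ ε₀ → ∃ β₀ : ℝ, 0 < β₀ ∧ ∀ β : ℝ, 0 < β → β ≤ β₀ →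
    ∀ (N : ℕ) [NeZero N] (αh νh κh : ℝ), 1 ≤ N →
    -- the k-free ceilings `(α̂, ν̂, κ̂)` of the honest per-pair binder and ONE k-free strict line (F327)
    2 * κh < ((((1 / 2 - νh ^ 2) / (2 * (1 + CE)) - νh ^ 2) / 2 - 576 * ((4 : ℕ) : ℝ) * (αh ^ 2 * Real.exp (2 * αh))) / (Fintype.card n : ℝ) - 28 * ((4 : ℕ) : ℝ) * (ε + 7 * αh ^ 2)) →
    -- THE HONEST PER-PAIR BINDER WITH THE SUP HALF SUPPLIED (`hdecomp♭`: the decomposition + energy letters of a residual near-representative)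
    (∀ D : Site 4 → Fin 4 → (Matrix n n ℂ)ˣ, IsUnitaryCfg D → IsPeriodicCfg D (N : ℤ) → SmallField D (4 * (Real.exp β - 1)) → ∀ (k : ℕ), ∀ Us ∈ admissible (sfClass 4 L N ε) L (k + 1) D, SmallField Us ((1 / (L : ℝ) ^ 2 * ε / 2) / ((L : ℝ) ^ (k + 1)) ^ 2) → (∀ φ : Site 4 → Fin 4 → Matrix n n ℂ, IsSkewDir φ → IsPeriodicDir φ ((N * L ^ (k + 1) : ℕ) : ℤ) → TangentIter L k Us φ → dAction Us φ (perWin 4 (N * L ^ (k + 1))) = 0) → ∀ U' ∈ admissible (sfClass 4 L N ε) L (k + 1) D,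
      -- NEW (gen 94): GIVEN ANY RESIDUAL NEAR-REPRESENTATIVE — a unitary `(N·M)`-periodic corner-trivial gauge in which `U′` is `10³⁴·ε∕M`-close to `U_s` bondwise
      ∀ u₀ : Site 4 → (Matrix n n ℂ)ˣ, IsUnitarySite u₀ → IsPeriodicSite u₀ ((N * L ^ (k + 1) : ℕ) : ℤ) → (∀ z : Site 4, u₀ (((L ^ (k + 1) : ℕ) : ℤ) • z) = 1) →
        (∀ (x : Site 4) (μ : Fin 4), ‖(((Us x μ)⁻¹ * gaugeAct u₀ U' x μ : (Matrix n n ℂ)ˣ) : Matrix n n ℂ) - 1‖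
          ≤ 10000000000000000000000000000000000 * (L : ℝ) ^ (k + 1) * (ε / ((L : ℝ) ^ (k + 1)) ^ 2)) →
      ∃ (u : Site 4 → (Matrix n n ℂ)ˣ) (X XT XN : Site 4 → Fin 4 → Matrix n n ℂ) (α ν κ : ℝ),
        IsUnitarySite u ∧ IsSkewDir X ∧ IsPeriodicDir X ((N * L ^ (k + 1) : ℕ) : ℤ) ∧ 0 ≤ α ∧ (∀ x μ, ‖X x μ‖ ≤ α) ∧
        gaugeAct u U' = vary Us X 1 ∧
        X = XT + XN ∧ XT ∈ energyBlockLandauW (d := 4) (n := n) L N (k + 1) Us ∧ IsSkewDir XN ∧ 0 ≤ ν ∧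
        energyNormW L (k + 1) Us XN (periodBox (d := 4) (N * L ^ (k + 1)))
          ≤ ν * energyNormW L (k + 1) Us X (periodBox (d := 4) (N * L ^ (k + 1))) ∧
        ε / ((L : ℝ) ^ (k + 1)) ^ 2 * (∑ p ∈ perWin 4 (N * L ^ (k + 1)), ‖curl Us XN p‖)
          ≤ κ * energyNormW L (k + 1) Us X (periodBox (d := 4) (N * L ^ (k + 1))) ^ 2 ∧
        α * (L : ℝ) ^ (k + 1) ≤ αh ∧ ν ≤ νh ∧ κ ≤ κh) →
    ∃ δV : ℝ, 0 < δV ∧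
      ∀ V ∈ {V : Site 4 → Fin 4 → (Matrix n n ℂ)ˣ | IsUnitaryCfg V ∧ IsPeriodicCfg V (N : ℤ) ∧ SmallField V δV},
      ∀ k : ℕ, ∃ U : Site 4 → Fin 4 → (Matrix n n ℂ)ˣ, IsMinimiser 4 (sfClass 4 L N ε) L N k V U ∧
        ∃ a : ℝ, 0 ≤ a ∧ a < ε / ((L : ℝ) ^ k) ^ 2 ∧ SmallField U a
    := by
  have hL0 : (0 : ℝ) < L := by exact_mod_cast (show 0 < L by omega)
  have hL6 : (0 : ℝ) < (L : ℝ) ^ 6 := by positivity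
  have hcard : (0 : ℝ) < (Fintype.card n : ℝ) := by exact_mod_cast Fintype.card_pos
  obtain ⟨CE, hCE, ℓ, hℓ1, ε₀, hε₀, H⟩ := hint_generic (n := n) hL
  set ε₂ : ℝ := 1 / (2 * (1000000000000000000000 * (L : ℝ) ^ 6 * (Fintype.card n : ℝ))) with hε₂
  have hε₂0 : 0 < ε₂ := by positivity
  refine ⟨CE, hCE, ℓ, hℓ1, min ε₀ ε₂, lt_min hε₀ hε₂0, fun ε hε hεle => ?_⟩
  obtain ⟨β₀, hβ₀, H2⟩ := H ε hε (hεle.trans (min_le_left _ _))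
  refine ⟨β₀, hβ₀, fun β hβ hβle N _ αh νh κh hN hline hdecomp => ?_⟩
  have hε21 : ε ≤ ε₂ := hεle.trans (min_le_right _ _)
  refine H2 β hβ hβle N αh νh κh hN hline ?_
  intro D hD hDP hDS k Us hUs hUsS hcrit U' hU'
  -- the pair's relative sup datum from `pair_residual_sup_rep_generic`
  have hUs' : IsUnitaryCfg Us ∧ IsPeriodicCfg Us ((N * L ^ (k + 1) : ℕ) : ℤ) ∧ SmallField Us (ε / ((L : ℝ) ^ (k + 1)) ^ 2) := hUs.1
  have hU'' : IsUnitaryCfg U' ∧ IsPeriodicCfg U' ((N * L ^ (k + 1) : ℕ) : ℤ) ∧ SmallField U' (ε / ((L : ℝ) ^ (k + 1)) ^ 2) := hU'.1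
  have htop : cavgIter L (k + 1) U' = cavgIter L (k + 1) Us := by
    rw [cavgIter_eq_avgIter, cavgIter_eq_avgIter, hU'.2, hUs.2]
  have hη : 0 < ε / ((L : ℝ) ^ (k + 1)) ^ 2 := by positivity
  have hθ : 1000000000000000000000 * (L : ℝ) ^ 6 * (Fintype.card n : ℝ) * (((L : ℝ) ^ (k + 1)) ^ 2 * (ε / ((L : ℝ) ^ (k + 1)) ^ 2)) ≤ 1 := by
    have hM0 : (0 : ℝ) < (L : ℝ) ^ (k + 1) := by positivity
    have hid : ((L : ℝ) ^ (k + 1)) ^ 2 * (ε / ((L : ℝ) ^ (k + 1)) ^ 2) = ε := by field_simp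
    rw [hid]
    have h1 : 1000000000000000000000 * (L : ℝ) ^ 6 * (Fintype.card n : ℝ) * ε
        ≤ 1000000000000000000000 * (L : ℝ) ^ 6 * (Fintype.card n : ℝ) * ε₂ := mul_le_mul_of_nonneg_left hε21 (by positivity)
    have h2 : 1000000000000000000000 * (L : ℝ) ^ 6 * (Fintype.card n : ℝ) * ε₂ = 1 / 2 := by rw [hε₂]; field_simp
    linarith
  obtain ⟨u₀, hu₀U, hu₀P, hu₀pin, hu₀err⟩ :=
    pair_residual_sup_rep_generic hL hU''.1 hUs'.1 hN hU''.2.1 hUs'.2.1 hη hU''.2.2 hUs'.2.2 htop hθ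
  exact hdecomp D hD hDP hDS k Us hUs hUsS hcrit U' hU' u₀ hu₀U hu₀P hu₀pin hu₀err

end Summit.QuantumFields.BalabanUV.T4Continuum.NE7HintOfSliceNormalisationGeneric
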